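import Summits.Parity.BatemanHorn.Theses.RoughValueTransport
import Literature.NumberTheory.Sieve.RoughNumbersBuchstab
import Literature.NumberTheory.Sieve.ParityWave0Proofs

/-!
# `BalancedSemiprimeLayer` (crux stmt-Parity-9469): the rough-value layer of the system `(X)`

Negative-side analytic core (cdisprove, refuter-cdisprove-stmt-Parity-9469-g2-0), all PROVED from tree
theorems (the prime number theorem `tendsto_primeCounting_mul_log_div` and the integer Buchstab law
`exists_abs_card_roughIcc_sub_main_le_of_rpow`, Lichtman 2025 Lemma 6.1 / Harman App. A.2):

* `tendsto_card_roughIcc_mul_log_div` — `Φ(x, x^θ)·log x/x → ω(1/θ)/θ` for `1/3 ≤ θ < 1`;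
* `tendsto_card_roughIcc_half_mul_log_div` — at `θ = (1−δ)/2`, `0 ≤ δ ≤ 1/4`: limit `1 + log((1+δ)/(1−δ))`;
* `tendsto_card_roughIcc_one_sub_mul_log_div` — at `θ = 1 − δ`, `0 < δ ≤ 1/4`: limit `1`;
* (PNT along `ℕ` is the tree's `Literature.NumberTheory.Sieve.tendsto_primeCounting_mul_log_div`);
* `tendsto_layer_X` — `(Φ(x, x^{(1−δ)/2}) − π(x))·log x/x → log((1+δ)/(1−δ))`: the balanced-semiprime
  layer of the Bateman–Horn system `(X)` at the crux's depth is `∼ log((1+δ)/(1−δ))·x/log x ≈ 2δx/log x`;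
* eventual inequalities from such limits, and `2δ ≤ log((1+δ)/(1−δ))`;
* the identification of the crux's left-hand count for the systems `(X)`, `(X, X)`, `(2, X)`, `(X²)`
  with `#roughIcc` (`card_cruxFilter_X`, `…_X_X`, `…_two_X`, `…_X_sq`) and of `polyPrimeCount` for
  them (`polyPrimeCount_X`, `…_X_X`, `…_two_X`, `…_X_sq`).

These feed the refutations / tightness results in the sibling `Negative/*.lean` files.
-/

namespace Summit.Parity.BatemanHorn.Theorems.BalancedSemiprimeLayer.Negative

open Filter Finset Polynomial Real Asymptotics
open scoped Topology
open Literature.NumberTheory.Sieve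

/-! ### The crux's sifting condition on the witness systems -/

/-- The crux's sifting condition on an integer coordinate is roughness. [folklore] -/
theorem filter_rough_eq_roughIcc (N x : ℕ) :
    (Icc 1 x).filter (fun n : ℕ => 0 < (n : ℤ) ∧ ∀ p ∈ range N, p.Prime → ¬ ((p : ℤ) ∣ (n : ℤ))) =
      roughIcc N x := by
  unfold roughIcc
  refine filter_congr fun n hn => ?_
  rw [mem_Icc] at hn
  constructor
  · rintro ⟨-, h⟩ p hp
    have hp' := Nat.prime_of_mem_primeFactors hp
    have hpn := Nat.dvd_of_mem_primeFactors hp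
    by_contra hlt
    exact h p (mem_range.mpr (not_le.mp hlt)) hp' (Int.natCast_dvd_natCast.mpr hpn)
  · intro h
    refine ⟨by exact_mod_cast hn.1, fun p hp hpp hpn => ?_⟩
    have hmem : p ∈ n.primeFactors :=
      Nat.mem_primeFactors.mpr ⟨hpp, Int.natCast_dvd_natCast.mp hpn, by omega⟩
    exact absurd (h p hmem) (not_le.mpr (mem_range.mp hp))

/-- `Φ_{(X)}(x, δ) = Φ(x, x^{(1−δ)/2})`. [folklore] -/
theorem card_cruxFilter_X (δ : ℝ) (x : ℕ) :
    #((Icc 1 x).filter (fun n : ℕ => ∀ i, 0 < (![(X : ℤ[X])] i).eval (n : ℤ) ∧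
      ∀ p ∈ range ⌈(x : ℝ) ^ (((![(X : ℤ[X])] i).natDegree : ℝ) * (1 - δ) / 2)⌉₊,
        p.Prime → ¬ ((p : ℤ) ∣ (![(X : ℤ[X])] i).eval (n : ℤ)))) =
      #(roughIcc ⌈(x : ℝ) ^ ((1 - δ) / 2)⌉₊ x) := by
  rw [← filter_rough_eq_roughIcc]
  congr 1
  refine filter_congr fun n _ => ?_
  simp only [Fin.forall_fin_one, Matrix.cons_val_fin_one, eval_X, natDegree_X, Nat.cast_one, one_mul]

/-- `Φ_{(X,X)}(x, δ) = Φ(x, x^{(1−δ)/2})`. [folklore] -/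
theorem card_cruxFilter_X_X (δ : ℝ) (x : ℕ) :
    #((Icc 1 x).filter (fun n : ℕ => ∀ i, 0 < (![(X : ℤ[X]), X] i).eval (n : ℤ) ∧
      ∀ p ∈ range ⌈(x : ℝ) ^ (((![(X : ℤ[X]), X] i).natDegree : ℝ) * (1 - δ) / 2)⌉₊,
        p.Prime → ¬ ((p : ℤ) ∣ (![(X : ℤ[X]), X] i).eval (n : ℤ)))) =
      #(roughIcc ⌈(x : ℝ) ^ ((1 - δ) / 2)⌉₊ x) := by
  rw [← filter_rough_eq_roughIcc]
  congr 1
  refine filter_congr fun n _ => ?_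
  simp only [Fin.forall_fin_two, Matrix.cons_val_zero, Matrix.cons_val_one, eval_X, natDegree_X,
    Nat.cast_one, one_mul, and_self]

/-- `Φ_{(2,X)}(x, δ) = Φ(x, x^{(1−δ)/2})`: the constant coordinate is sifted by no prime. [folklore] -/
theorem card_cruxFilter_two_X (δ : ℝ) (x : ℕ) :
    #((Icc 1 x).filter (fun n : ℕ => ∀ i, 0 < (![C (2 : ℤ), (X : ℤ[X])] i).eval (n : ℤ) ∧
      ∀ p ∈ range ⌈(x : ℝ) ^ (((![C (2 : ℤ), (X : ℤ[X])] i).natDegree : ℝ) * (1 - δ) / 2)⌉₊,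
        p.Prime → ¬ ((p : ℤ) ∣ (![C (2 : ℤ), (X : ℤ[X])] i).eval (n : ℤ)))) =
      #(roughIcc ⌈(x : ℝ) ^ ((1 - δ) / 2)⌉₊ x) := by
  rw [← filter_rough_eq_roughIcc]
  congr 1
  refine filter_congr fun n _ => ?_
  simp only [Fin.forall_fin_two, Matrix.cons_val_zero, Matrix.cons_val_one, eval_X, natDegree_X,
    Nat.cast_one, one_mul, eval_C, natDegree_C, CharP.cast_eq_zero, zero_mul, zero_div,
    Real.rpow_zero, Nat.ceil_one, Finset.range_one, Finset.mem_singleton, forall_eq,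
    Nat.not_prime_zero, IsEmpty.forall_iff, and_true]
  simp

/-- `Φ_{(X²)}(x, δ) = Φ(x, x^{1−δ})`. [folklore] -/
theorem card_cruxFilter_X_sq (δ : ℝ) (x : ℕ) :
    #((Icc 1 x).filter (fun n : ℕ => ∀ i, 0 < (![(X ^ 2 : ℤ[X])] i).eval (n : ℤ) ∧
      ∀ p ∈ range ⌈(x : ℝ) ^ (((![(X ^ 2 : ℤ[X])] i).natDegree : ℝ) * (1 - δ) / 2)⌉₊,
        p.Prime → ¬ ((p : ℤ) ∣ (![(X ^ 2 : ℤ[X])] i).eval (n : ℤ)))) =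
      #(roughIcc ⌈(x : ℝ) ^ (1 - δ)⌉₊ x) := by
  rw [← filter_rough_eq_roughIcc]
  congr 1
  refine filter_congr fun n hn => ?_
  rw [mem_Icc] at hn
  simp only [Fin.forall_fin_one, Matrix.cons_val_fin_one, eval_pow, eval_X, natDegree_pow,
    natDegree_X, mul_one, Nat.cast_ofNat]
  have he : (2 : ℝ) * (1 - δ) / 2 = 1 - δ := by ring
  rw [he]
  have hn0 : (0 : ℤ) < n := by exact_mod_cast hn.1
  have hdvd : ∀ p : ℕ, p.Prime → (((p : ℤ) ∣ (n : ℤ) ^ 2) ↔ ((p : ℤ) ∣ (n : ℤ))) := by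
    intro p hp
    rw [← Nat.cast_pow, Int.natCast_dvd_natCast, Int.natCast_dvd_natCast]
    exact ⟨hp.dvd_of_dvd_pow, fun h => h.trans (dvd_pow_self n two_ne_zero)⟩
  constructor
  · rintro ⟨-, h⟩
    exact ⟨hn0, fun p hp hpp => (hdvd p hpp).not.mp (h p hp hpp)⟩
  · rintro ⟨-, h⟩
    exact ⟨by positivity, fun p hp hpp => (hdvd p hpp).not.mpr (h p hp hpp)⟩

/-- `P_{(X)}(x) = π(x)`. [folklore] -/
theorem polyPrimeCount_X (x : ℕ) : polyPrimeCount ![(X : ℤ[X])] x = Nat.primeCounting x := by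
  rw [← Nat.primesLE_card_eq_primeCounting, Nat.primesLE_eq_filter_range]
  unfold polyPrimeCount
  congr 1
  ext n
  simp only [mem_filter, Fin.forall_fin_one, Matrix.cons_val_fin_one, eval_X, Int.toNat_natCast]
  exact and_congr_right fun _ => ⟨fun h => h.2, fun h => ⟨by exact_mod_cast h.pos, h⟩⟩

/-- `P_{(X,X)}(x) = π(x)`. [folklore] -/
theorem polyPrimeCount_X_X (x : ℕ) : polyPrimeCount ![(X : ℤ[X]), X] x = Nat.primeCounting x := by
  rw [← Nat.primesLE_card_eq_primeCounting, Nat.primesLE_eq_filter_range]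
  unfold polyPrimeCount
  congr 1
  ext n
  simp only [mem_filter, Fin.forall_fin_two, Matrix.cons_val_zero, Matrix.cons_val_one, eval_X,
    Int.toNat_natCast, and_self]
  exact and_congr_right fun _ => ⟨fun h => h.2, fun h => ⟨by exact_mod_cast h.pos, h⟩⟩

/-- `P_{(2,X)}(x) = π(x)`. [folklore] -/
theorem polyPrimeCount_two_X (x : ℕ) :
    polyPrimeCount ![C (2 : ℤ), (X : ℤ[X])] x = Nat.primeCounting x := by
  rw [← Nat.primesLE_card_eq_primeCounting, Nat.primesLE_eq_filter_range]
  unfold polyPrimeCount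
  congr 1
  ext n
  simp only [mem_filter, Fin.forall_fin_two, Matrix.cons_val_zero, Matrix.cons_val_one, eval_X,
    eval_C, Int.toNat_natCast]
  refine and_congr_right fun _ => ⟨fun h => h.2.2, fun h => ⟨⟨by norm_num, by decide⟩, by exact_mod_cast h.pos, h⟩⟩

/-- `P_{(X²)}(x) = 0`: a square is never prime. [folklore] -/
theorem polyPrimeCount_X_sq (x : ℕ) : polyPrimeCount ![(X ^ 2 : ℤ[X])] x = 0 := by
  unfold polyPrimeCount
  rw [Finset.card_eq_zero, Finset.eq_empty_iff_forall_notMem]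
  intro n hn
  simp only [mem_filter, Fin.forall_fin_one, Matrix.cons_val_fin_one, eval_pow, eval_X] at hn
  have h := hn.2.2
  rw [← Nat.cast_pow, Int.toNat_natCast, sq] at h
  rcases eq_or_ne n 1 with rfl | hn1
  · exact Nat.not_prime_one (by simpa using h)
  · exact Nat.not_prime_mul hn1 hn1 h

/-! ### The prime number theorem along `ℕ` and the integer Buchstab law as a limit -/

/-- **Core asymptotic** (the integer Buchstab law of the tree, PROVED
`exists_abs_card_roughIcc_sub_main_le_of_rpow`, read as a limit): for `1/3 ≤ θ < 1`,
`Φ(x, x^θ) · log x / x → ω(1/θ)/θ = u ω(u)`, `u = 1/θ`. [cite: Lichtman2025LinearSieve, Lemma 6.1] -/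
theorem tendsto_card_roughIcc_mul_log_div {θ : ℝ} (hθ : 1 / 3 ≤ θ) (hθ1 : θ < 1) :
    Tendsto (fun x : ℕ => (#(roughIcc ⌈(x : ℝ) ^ θ⌉₊ x) : ℝ) * Real.log x / x) atTop
      (𝓝 (buchstabOmega (1 / θ) / θ)) := by
  obtain ⟨C, hC0, hC⟩ := exists_abs_card_roughIcc_sub_main_le_of_rpow 3
  have hθ0 : 0 < θ := by linarith
  set L : ℝ := buchstabOmega (1 / θ) / θ with hL
  -- the error majorant tends to `0`
  have hmaj : Tendsto (fun x : ℕ => (x : ℝ) ^ (θ - 1) / θ + C / (θ ^ 2 * Real.log x)) atTop (𝓝 0) := by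
    have h1 : Tendsto (fun x : ℕ => (x : ℝ) ^ (θ - 1)) atTop (𝓝 0) := by
      have := (tendsto_rpow_neg_atTop (by linarith : 0 < 1 - θ)).comp tendsto_natCast_atTop_atTop
      refine this.congr' (Eventually.of_forall fun x => ?_)
      simp only [Function.comp_apply]
      congr 1
      ring
    have h2 : Tendsto (fun x : ℕ => C / (θ ^ 2 * Real.log x)) atTop (𝓝 0) := by
      have hl : Tendsto (fun x : ℕ => θ ^ 2 * Real.log x) atTop atTop :=
        Tendsto.const_mul_atTop (by positivity)
          (Real.tendsto_log_atTop.comp tendsto_natCast_atTop_atTop)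
      have := hl.inv_tendsto_atTop.const_mul C
      rw [mul_zero] at this
      refine this.congr' (Eventually.of_forall fun x => ?_)
      simp [div_eq_mul_inv]
    simpa using (h1.div_const θ).add h2
  -- the eventual bound `|Φ log x / x − L| ≤ x^{θ−1}/θ + C/(θ² log x)`
  have hbound : ∀ᶠ x : ℕ in atTop,
      |(#(roughIcc ⌈(x : ℝ) ^ θ⌉₊ x) : ℝ) * Real.log x / x - L| ≤
        (x : ℝ) ^ (θ - 1) / θ + C / (θ ^ 2 * Real.log x) := by
    have hy : Tendsto (fun x : ℕ => (x : ℝ) ^ θ) atTop atTop :=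
      (tendsto_rpow_atTop hθ0).comp tendsto_natCast_atTop_atTop
    filter_upwards [hy.eventually_ge_atTop 2, eventually_ge_atTop 2] with x hx2 hx
    have hxR : (2 : ℝ) ≤ x := by exact_mod_cast hx
    have hx0 : (0 : ℝ) < x := by linarith
    have hx1 : (1 : ℝ) ≤ x := by linarith
    have hlogx : 0 < Real.log x := Real.log_pos (by linarith)
    have hyx : (x : ℝ) ^ θ ≤ x := by
      calc (x : ℝ) ^ θ ≤ (x : ℝ) ^ (1 : ℝ) := Real.rpow_le_rpow_of_exponent_le hx1 hθ1.le
        _ = x := Real.rpow_one _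
    have hxy3 : (x : ℝ) ≤ ((x : ℝ) ^ θ) ^ (3 : ℝ) := by
      rw [← Real.rpow_mul hx0.le]
      calc (x : ℝ) = (x : ℝ) ^ (1 : ℝ) := (Real.rpow_one _).symm
        _ ≤ (x : ℝ) ^ (θ * 3) := Real.rpow_le_rpow_of_exponent_le hx1 (by linarith)
    have hlogy : Real.log ((x : ℝ) ^ θ) = θ * Real.log x := Real.log_rpow hx0 θ
    have hu : Real.log x / Real.log ((x : ℝ) ^ θ) = 1 / θ := by
      rw [hlogy]
      field_simp
    have h := hC x ((x : ℝ) ^ θ) hx2 hyx hxy3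
    rw [Nat.floor_natCast, hu, hlogy] at h
    have hkey : (#(roughIcc ⌈(x : ℝ) ^ θ⌉₊ x) : ℝ) * Real.log x / x - L =
        ((#(roughIcc ⌈(x : ℝ) ^ θ⌉₊ x) : ℝ) -
            (x * buchstabOmega (1 / θ) - (x : ℝ) ^ θ) / (θ * Real.log x)) * (Real.log x / x) -
          (x : ℝ) ^ θ / (θ * x) := by
      rw [hL]
      field_simp
      ring
    rw [hkey]
    have hlx : 0 < Real.log x / x := by positivity
    calc |((#(roughIcc ⌈(x : ℝ) ^ θ⌉₊ x) : ℝ) -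
              (x * buchstabOmega (1 / θ) - (x : ℝ) ^ θ) / (θ * Real.log x)) * (Real.log x / x) -
            (x : ℝ) ^ θ / (θ * x)|
        ≤ |((#(roughIcc ⌈(x : ℝ) ^ θ⌉₊ x) : ℝ) -
              (x * buchstabOmega (1 / θ) - (x : ℝ) ^ θ) / (θ * Real.log x)) * (Real.log x / x)| +
            |(x : ℝ) ^ θ / (θ * x)| := abs_sub _ _
      _ = |(#(roughIcc ⌈(x : ℝ) ^ θ⌉₊ x) : ℝ) -
              (x * buchstabOmega (1 / θ) - (x : ℝ) ^ θ) / (θ * Real.log x)| * (Real.log x / x) +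
            (x : ℝ) ^ θ / (θ * x) := by
          rw [abs_mul, abs_of_pos hlx,
            abs_of_nonneg (div_nonneg (Real.rpow_nonneg hx0.le θ) (mul_pos hθ0 hx0).le)]
      _ ≤ C * x / (θ * Real.log x) ^ 2 * (Real.log x / x) + (x : ℝ) ^ θ / (θ * x) := by gcongr
      _ = (x : ℝ) ^ (θ - 1) / θ + C / (θ ^ 2 * Real.log x) := by
          rw [Real.rpow_sub_one hx0.ne']
          field_simp
          ring
  rw [tendsto_iff_norm_sub_tendsto_zero]
  refine squeeze_zero' (Eventually.of_forall fun x => norm_nonneg _) ?_ hmaj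
  filter_upwards [hbound] with x hx
  simpa only [Real.norm_eq_abs] using hx

/-- **At the crux's depth for a linear coordinate**: `Φ(x, x^{(1−δ)/2})·log x/x → 1 + log((1+δ)/(1−δ))`
for `0 ≤ δ ≤ 1/4` (`u = 2/(1−δ) ∈ [2, 8/3]`, `u ω(u) = 1 + log(u − 1)`). [folklore] -/
theorem tendsto_card_roughIcc_half_mul_log_div {δ : ℝ} (hδ0 : 0 ≤ δ) (hδ : δ ≤ 1 / 4) :
    Tendsto (fun x : ℕ => (#(roughIcc ⌈(x : ℝ) ^ ((1 - δ) / 2)⌉₊ x) : ℝ) * Real.log x / x) atTop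
      (𝓝 (1 + Real.log ((1 + δ) / (1 - δ)))) := by
  have hθ : (1 : ℝ) / 3 ≤ (1 - δ) / 2 := by linarith
  have hθ1 : (1 - δ) / 2 < 1 := by linarith
  have h := tendsto_card_roughIcc_mul_log_div hθ hθ1
  have hval : buchstabOmega (1 / ((1 - δ) / 2)) / ((1 - δ) / 2) =
      1 + Real.log ((1 + δ) / (1 - δ)) := by
    have hu2 : (2 : ℝ) ≤ 1 / ((1 - δ) / 2) := by
      rw [le_div_iff₀ (by linarith)]; linarith
    have hu3 : 1 / ((1 - δ) / 2) ≤ 3 := by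
      rw [div_le_iff₀ (by linarith)]; linarith
    rw [buchstabOmega_eq_of_mem_Icc_two_three hu2 hu3]
    have hne : (1 : ℝ) - δ ≠ 0 := ne_of_gt (by linarith)
    have h1 : 1 / ((1 - δ) / 2) - 1 = (1 + δ) / (1 - δ) := by
      field_simp
      ring
    rw [h1]
    field_simp
  rwa [hval] at h

/-- **At the crux's depth for the square `(X²)`**: `Φ(x, x^{1−δ})·log x/x → 1` for `0 < δ ≤ 1/4`
(`u = 1/(1−δ) ∈ (1, 4/3]`, `ω(u) = 1/u`). [folklore] -/
theorem tendsto_card_roughIcc_one_sub_mul_log_div {δ : ℝ} (hδ0 : 0 < δ) (hδ : δ ≤ 1 / 4) :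
    Tendsto (fun x : ℕ => (#(roughIcc ⌈(x : ℝ) ^ (1 - δ)⌉₊ x) : ℝ) * Real.log x / x) atTop (𝓝 1) := by
  have hθ : (1 : ℝ) / 3 ≤ 1 - δ := by linarith
  have hθ1 : 1 - δ < 1 := by linarith
  have h := tendsto_card_roughIcc_mul_log_div hθ hθ1
  have hval : buchstabOmega (1 / (1 - δ)) / (1 - δ) = 1 := by
    have hu1 : (1 : ℝ) ≤ 1 / (1 - δ) := by
      rw [le_div_iff₀ (by linarith)]; linarith
    have hu2 : 1 / (1 - δ) ≤ 2 := by
      rw [div_le_iff₀ (by linarith)]; linarith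
    rw [buchstabOmega_eq_inv hu1 hu2]
    have hne : (1 : ℝ) - δ ≠ 0 := ne_of_gt (by linarith)
    field_simp
  rwa [hval] at h

/-- **The `(X)`-layer asymptotic**: `(Φ(x, x^{(1−δ)/2}) − π(x))·log x/x → log((1+δ)/(1−δ))`, i.e.
the balanced-semiprime layer of the Bateman–Horn system `(X)` at the crux's depth is
`∼ log((1+δ)/(1−δ))·x/log x ≈ 2δ·x/log x` (the `k = 1`, `f = (X)` instance of RoughValueLaw + PNT).
[folklore] -/
theorem tendsto_layer_X {δ : ℝ} (hδ0 : 0 ≤ δ) (hδ : δ ≤ 1 / 4) :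
    Tendsto (fun x : ℕ => ((#(roughIcc ⌈(x : ℝ) ^ ((1 - δ) / 2)⌉₊ x) : ℝ) -
        (Nat.primeCounting x : ℝ)) * Real.log x / x) atTop
      (𝓝 (Real.log ((1 + δ) / (1 - δ)))) := by
  have h := (tendsto_card_roughIcc_half_mul_log_div hδ0 hδ).sub tendsto_primeCounting_mul_log_div
  rw [add_sub_cancel_left] at h
  refine h.congr' (Eventually.of_forall fun x => ?_)
  ring

/-! ### From limits to eventual inequalities -/

/-- `a·log x/x → L`, `c < L` ⇒ eventually `c·x/log x < a`. [folklore] -/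
theorem eventually_mul_div_log_lt {a : ℕ → ℝ} {L c : ℝ}
    (h : Tendsto (fun x : ℕ => a x * Real.log x / x) atTop (𝓝 L)) (hc : c < L) :
    ∀ᶠ x : ℕ in atTop, c * x / Real.log x < a x := by
  filter_upwards [h.eventually (eventually_gt_nhds hc), eventually_gt_atTop 1] with x hx hx1
  have hx' : (1 : ℝ) < x := by exact_mod_cast hx1
  have hlog : 0 < Real.log x := Real.log_pos hx'
  have hx0 : (0 : ℝ) < x := by linarith
  rw [lt_div_iff₀ hx0] at hx
  rw [div_lt_iff₀ hlog]
  linarith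

/-- `a·log x/x → L`, `L < c` ⇒ eventually `a < c·x/log x`. [folklore] -/
theorem eventually_lt_mul_div_log {a : ℕ → ℝ} {L c : ℝ}
    (h : Tendsto (fun x : ℕ => a x * Real.log x / x) atTop (𝓝 L)) (hc : L < c) :
    ∀ᶠ x : ℕ in atTop, a x < c * x / Real.log x := by
  filter_upwards [h.eventually (eventually_lt_nhds hc), eventually_gt_atTop 1] with x hx hx1
  have hx' : (1 : ℝ) < x := by exact_mod_cast hx1
  have hlog : 0 < Real.log x := Real.log_pos hx'
  have hx0 : (0 : ℝ) < x := by linarith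
  rw [div_lt_iff₀ hx0] at hx
  rw [lt_div_iff₀ hlog]
  linarith

/-- `a·log x/x → L > 0` ⇒ `a` beats every `ε·x/(log x)^m`, `m ≥ 2`, eventually. [folklore] -/
theorem eventually_mul_div_log_pow_lt {a : ℕ → ℝ} {L : ℝ}
    (h : Tendsto (fun x : ℕ => a x * Real.log x / x) atTop (𝓝 L)) (hL : 0 < L) (ε : ℝ) {m : ℕ}
    (hm : 2 ≤ m) : ∀ᶠ x : ℕ in atTop, ε * x / Real.log x ^ m < a x := by
  have h1 := eventually_mul_div_log_lt h (half_lt_self hL)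
  have hlog : Tendsto (fun x : ℕ => Real.log x) atTop atTop :=
    Real.tendsto_log_atTop.comp tendsto_natCast_atTop_atTop
  filter_upwards [h1, hlog.eventually_ge_atTop (max 1 (2 * ε / L)), eventually_gt_atTop 1]
    with x hx hlx hx1
  have hx' : (1 : ℝ) < x := by exact_mod_cast hx1
  have hx0 : (0 : ℝ) < x := by linarith
  have hl1 : 1 ≤ Real.log x := le_trans (le_max_left _ _) hlx
  have hl2 : 2 * ε / L ≤ Real.log x := le_trans (le_max_right _ _) hlx
  have hlpos : 0 < Real.log x := by linarith
  refine lt_of_le_of_lt ?_ hx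
  rw [div_le_div_iff₀ (by positivity) hlpos]
  rw [div_le_iff₀ hL] at hl2
  have hε : ε * Real.log x ≤ L / 2 * Real.log x ^ m :=
    calc ε * Real.log x ≤ (L / 2 * Real.log x) * Real.log x := by
          apply mul_le_mul_of_nonneg_right _ hlpos.le
          linarith
      _ = L / 2 * Real.log x ^ 2 := by ring
      _ ≤ L / 2 * Real.log x ^ m :=
          mul_le_mul_of_nonneg_left (pow_le_pow_right₀ hl1 hm) (by linarith)
  nlinarith [mul_le_mul_of_nonneg_left hε hx0.le]

/-! ### `2δ ≤ log((1+δ)/(1−δ))` -/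

/-- `δ ≤ log((1+δ)/(1−δ))` for `0 ≤ δ < 1` (indeed `2δ ≤ …`; this much suffices here). [folklore] -/
theorem delta_le_log_ratio {δ : ℝ} (hδ0 : 0 ≤ δ) (hδ1 : δ < 1) :
    δ ≤ Real.log ((1 + δ) / (1 - δ)) := by
  have hpos : 0 < (1 + δ) / (1 - δ) := div_pos (by linarith) (by linarith)
  have h := Real.one_sub_inv_le_log_of_pos hpos
  have h2 : δ ≤ 1 - ((1 + δ) / (1 - δ))⁻¹ := by
    rw [inv_div, le_sub_iff_add_le, ← le_sub_iff_add_le', div_le_iff₀ (by linarith)]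
    nlinarith
  linarith

/-- The sharp form `2δ ≤ log((1+δ)/(1−δ)) = 2 artanh δ` (first term of the artanh series,
Mathlib's `Real.hasSum_log_sub_log_of_abs_lt_one`). [folklore] -/
theorem two_mul_le_log_ratio {δ : ℝ} (hδ0 : 0 ≤ δ) (hδ1 : δ < 1) :
    2 * δ ≤ Real.log ((1 + δ) / (1 - δ)) := by
  have h := Real.hasSum_log_sub_log_of_abs_lt_one (show |δ| < 1 by rw [abs_of_nonneg hδ0]; exact hδ1)
  have h2 := sum_le_hasSum {0} (fun i _ => by positivity) h
  rw [Finset.sum_singleton] at h2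
  norm_num at h2
  rw [Real.log_div (by linarith) (by linarith)]
  linarith

/-- `0 < log((1+δ)/(1−δ))` for `0 < δ < 1`. [folklore] -/
theorem log_ratio_pos {δ : ℝ} (hδ0 : 0 < δ) (hδ1 : δ < 1) : 0 < Real.log ((1 + δ) / (1 - δ)) :=
  Real.log_pos (by rw [one_lt_div (by linarith)]; linarith)

end Summit.Parity.BatemanHorn.Theorems.BalancedSemiprimeLayer.Negative
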